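import Summits.Ventures.PercRepro.S1DisjointSumRank

/-!
# PercRepro — COUNTING SUBSETS OF A DISJOINT UNION SLICE BY SLICE; THE PROFILE SLICES OF A DISJOINT SUM (p2, gen
27; SUBCLAIM-S1 §6.10 (xvii)(d))

The counting half of the «consumer that sees 1-separations»: the subsets `A` of a disjoint union `E₁ ∪ E₂` whose
traces lie in prescribed families `S₁ ⊆ 𝒫(E₁)`, `S₂ ⊆ 𝒫(E₂)` are counted by the product `|S₁| · |S₂|`
(`A ↦ (A ∩ E₁, A ∩ E₂)` is a bijection onto `S₁ ×ˢ S₂`); applied to the profile sets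
`N_M(a, b) = {A ⊆ M.E : ρ(A) = a, ρ(E ∖ A) = b}` of the two parts of `M.disjointSum N`, each slice of the
`U`-set of the C-025 body at `(p, q)` with prescribed trace ranks `(a₁, b₁)`, `(a₂, b₂)` has exactly
`|N_M(a₁, b₁)| · |N_N(a₂, b₂)|` members (S1DisjointSumRank's `disjointSum_mem_U_iff` says which slices occur:
`a₁ + a₂ = p`, `b₁ + b₂ = q`). The summation over the slices is left to the successor. Nothing is claimed about
any cell.

* **`ncard_trace_slices_eq_mul`** — the product count for a disjoint union;
* `profileSet` — the two-dimensional profile set of a matroid;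
* **`disjointSum_ncard_profile_slice_eq_mul`** — the slice of the `U`-set of a disjoint sum is a product.
Axioms: standard.
-/

open scoped Matroid

namespace PercRepro

namespace S1

open Set

variable {α : Type}

/-- **Subsets of a disjoint union with prescribed traces are counted by a product**: for disjoint `E₁`, `E₂` and
families `S₁ ⊆ 𝒫(E₁)`, `S₂ ⊆ 𝒫(E₂)`, the sets `A ⊆ E₁ ∪ E₂` with `A ∩ E₁ ∈ S₁` and `A ∩ E₂ ∈ S₂` number
`|S₁| · |S₂|`. -/
theorem ncard_trace_slices_eq_mul {E₁ E₂ : Set α} (h : Disjoint E₁ E₂) (S₁ S₂ : Set (Set α))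
    (hS₁ : ∀ A ∈ S₁, A ⊆ E₁) (hS₂ : ∀ A ∈ S₂, A ⊆ E₂) :
    {A : Set α | A ⊆ E₁ ∪ E₂ ∧ A ∩ E₁ ∈ S₁ ∧ A ∩ E₂ ∈ S₂}.ncard = S₁.ncard * S₂.ncard := by
  rw [← Set.ncard_prod]
  symm
  have hkey : ∀ A₁ ∈ S₁, ∀ A₂ ∈ S₂, (A₁ ∪ A₂) ∩ E₁ = A₁ ∧ (A₁ ∪ A₂) ∩ E₂ = A₂ := by
    intro A₁ h₁ A₂ h₂
    have hA₁ := hS₁ A₁ h₁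
    have hA₂ := hS₂ A₂ h₂
    constructor
    · ext x; constructor
      · rintro ⟨hx | hx, hxE⟩
        · exact hx
        · exact absurd hxE (h.symm.notMem_of_mem_left (hA₂ hx))
      · intro hx; exact ⟨Or.inl hx, hA₁ hx⟩
    · ext x; constructor
      · rintro ⟨hx | hx, hxE⟩
        · exact absurd hxE (h.notMem_of_mem_left (hA₁ hx))
        · exact hx
      · intro hx; exact ⟨Or.inr hx, hA₂ hx⟩
  refine Set.ncard_congr (fun P _ => P.1 ∪ P.2) ?_ ?_ ?_
  · rintro ⟨A₁, A₂⟩ ⟨h₁, h₂⟩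
    obtain ⟨e₁, e₂⟩ := hkey A₁ h₁ A₂ h₂
    refine ⟨union_subset ((hS₁ A₁ h₁).trans subset_union_left) ((hS₂ A₂ h₂).trans subset_union_right), ?_, ?_⟩
    · rw [e₁]; exact h₁
    · rw [e₂]; exact h₂
  · rintro ⟨A₁, A₂⟩ ⟨B₁, B₂⟩ ⟨h₁, h₂⟩ ⟨g₁, g₂⟩ heq
    obtain ⟨e₁, e₂⟩ := hkey A₁ h₁ A₂ h₂
    obtain ⟨f₁, f₂⟩ := hkey B₁ g₁ B₂ g₂
    have hA₁ : A₁ = B₁ := by rw [← e₁, ← f₁, heq]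
    have hA₂ : A₂ = B₂ := by rw [← e₂, ← f₂, heq]
    rw [hA₁, hA₂]
  · rintro A ⟨hA, h₁, h₂⟩
    refine ⟨(A ∩ E₁, A ∩ E₂), ⟨h₁, h₂⟩, ?_⟩
    show A ∩ E₁ ∪ A ∩ E₂ = A
    rw [← inter_union_distrib_left, inter_eq_self_of_subset_left hA]

/-- The two-dimensional profile set of `M`: the subsets of `E` of rank `a` whose complement has rank `b`. -/
def profileSet (M : Matroid α) (a b : ℕ) : Set (Set α) :=
  {A : Set α | A ⊆ M.E ∧ M.eRk A = a ∧ M.eRk (M.E \ A) = b}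

/-- **A slice of the `U`-set of a disjoint sum is a product of profile sets**: the sets `A ⊆ M.E ∪ N.E` whose
trace on `M.E` has rank `a₁` with complement rank `b₁`, and whose trace on `N.E` has rank `a₂` with complement
rank `b₂`, number `|N_M(a₁, b₁)| · |N_N(a₂, b₂)|`. -/
theorem disjointSum_ncard_profile_slice_eq_mul (M N : Matroid α) (h : Disjoint M.E N.E) (a₁ b₁ a₂ b₂ : ℕ) :
    {A : Set α | A ⊆ M.E ∪ N.E ∧ M.eRk (A ∩ M.E) = a₁ ∧ M.eRk (M.E \ A) = b₁ ∧
        N.eRk (A ∩ N.E) = a₂ ∧ N.eRk (N.E \ A) = b₂}.ncard =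
      (profileSet M a₁ b₁).ncard * (profileSet N a₂ b₂).ncard := by
  rw [← ncard_trace_slices_eq_mul h (profileSet M a₁ b₁) (profileSet N a₂ b₂)
    (fun A hA => hA.1) (fun A hA => hA.1)]
  congr 1
  ext A
  simp only [mem_setOf_eq, profileSet]
  have e₁ : M.E \ (A ∩ M.E) = M.E \ A := by
    ext x; simp only [mem_sdiff, mem_inter_iff, not_and]; tauto
  have e₂ : N.E \ (A ∩ N.E) = N.E \ A := by
    ext x; simp only [mem_sdiff, mem_inter_iff, not_and]; tauto
  rw [e₁, e₂]
  constructor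
  · rintro ⟨hA, h1, h2, h3, h4⟩
    exact ⟨hA, ⟨inter_subset_right, h1, h2⟩, ⟨inter_subset_right, h3, h4⟩⟩
  · rintro ⟨hA, ⟨-, h1, h2⟩, ⟨-, h3, h4⟩⟩
    exact ⟨hA, h1, h2, h3, h4⟩

end S1

end PercRepro
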